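import Summits.CriticalPhenomena.Ising3DConformalLimit.Theorems.EnergyNotSigmaSquaredGapForcesFarMergingFloorsNecessity

/-! # Floors from corridor separation under the screening tilt
(line `screening-form-lemma-a1` of crux `GapForcesFarMerging`, item stmt-CriticalPhenomena-4468;
helper file of the open stub `stub_floors`)

The landed `floors_of_separation` / `separation_of_floors` make the SEPARATION EVENT FORM
`c·A(r;m) ≤ E[𝟙{c·sw_r ≤ sw_{r'}}·sw_r]` an exact currency for `Floors`. This file isolates the weakest input
that yields the separation event by Griffiths antitonicity alone — CORRIDOR SEPARATION: with tilted
probability `≥ c` there is a corridor `q ∋ e₂` (from any finite family at scale `r`) which (i) the new piece of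
the duplicated cluster (`C_{2r} ∖ C_r`, resp. `C ∖ C_r` in the bulk geometry, where `q ∋ dn m` too) MISSES, and
(ii) carries a `c`-fraction of the depleted probe correlation, `c·S(C_r) ≤ S(C_r ∪ (Λ_{r'} ∖ q))`. On that event
`C_{r'} ⊆ C_r ∪ (Λ_{r'} ∖ q)`, so `S(C_{r'}) ≥ S(C_r ∪ (Λ_{r'} ∖ q)) ≥ c·S(C_r)` (`floorsNec_screening_anti`): the
separation event. (i) is the separation lemma under the tilt, (ii) a depleted Harnack/tube estimate — both open
on `ℤ³`; this file only certifies the bookkeeping `(i) ∧ (ii) ⇒ Floors`.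
References: Lawler 1991 ch. 3 (separation lemmas); ADC21 (arXiv:1912.07973) App. A. -/

noncomputable section

namespace Summit.CriticalPhenomena.Ising3DConformalLimit.EnergyNotSigmaSquaredGapForcesFarMerging

open scoped symmDiff ENNReal
open MeasureTheory Filter Finset
open Literature.Probability.LatticeModels Literature.Probability.Percolation
open Summit.CriticalPhenomena.Ising3DConformalLimit.Theorems.GapForcesFarMerging.Negative (e₁ e₂ cc2 xR up dn)
open Summit.CriticalPhenomena.Ising3DConformalLimit.GapForcesFarMergingScreening

/-! ### The corridor event forces the separation event, pointwise -/

/-- **Corridor ⇒ separation, pointwise.** If the new piece `C_{r'}(0) ∖ C_r(0)` misses a set `q ∋ e₂` with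
`dn m ∉ Λ_{r'} ∖ q`, and the corridor carries a `c`-fraction, `c·S(C_r) ≤ S(C_r ∪ (Λ_{r'} ∖ q))`, then
`c·sw_r ≤ sw_{r'}` (`C_{r'} ⊆ C_r ∪ (Λ_{r'} ∖ q)` and Griffiths antitonicity of the screening ratio).
[cite: AizenmanDuminilCopinAnnals2021, Appendix A, Corollary A.2] -/
theorem floorsCor_pointwise {n r r' m : ℕ} {c : ℝ} {q : Finset (Site 3)} {ω : BondConfig (Site 3)}
    (he : (e₂ : Site 3) ∈ box 3 n) (hd : dn m ∈ box 3 n) (heq : (e₂ : Site 3) ∈ q)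
    (hdq : dn m ∉ box 3 r' \ q) (hdis : Disjoint (innerCluster r' 0 ω \ innerCluster r 0 ω) q)
    (hc : c * screening n (innerCluster r 0 ω) e₂ (dn m) ≤
      screening n (innerCluster r 0 ω ∪ (box 3 r' \ q)) e₂ (dn m)) :
    c * screenWeight n r 0 e₂ (dn m) ω ≤ screenWeight n r' 0 e₂ (dn m) ω := by
  unfold screenWeight
  split_ifs with hC
  · rw [mul_zero]
  · push Not at hC
    refine hc.trans (floorsNec_screening_anti (T := innerCluster r' 0 ω) ?_ ?_ ?_)
    · -- `C_{r'} ⊆ C_r ∪ (Λ_{r'} ∖ q)`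
      intro v hv
      by_cases hvr : v ∈ innerCluster r 0 ω
      · exact Finset.mem_union_left _ hvr
      · refine Finset.mem_union_right _ (Finset.mem_sdiff.2 ⟨innerCluster_subset_box r' 0 ω hv, fun hvq => ?_⟩)
        exact Finset.disjoint_left.1 hdis (Finset.mem_sdiff.2 ⟨hv, hvr⟩) hvq
    · refine Finset.mem_sdiff.2 ⟨he, fun h => ?_⟩
      rcases Finset.mem_union.1 h with h | h
      · exact hC.1 (innerCluster_subset_openCluster r 0 ω _ h)
      · exact (Finset.mem_sdiff.1 h).2 heq
    · refine Finset.mem_sdiff.2 ⟨hd, fun h => ?_⟩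
      rcases Finset.mem_union.1 h with h | h
      · exact hC.2 (innerCluster_subset_openCluster r 0 ω _ h)
      · exact hdq h

/-- The far probe end lies outside the doubled octave: `dn m ∉ Λ_{2^{j+1}}` for `m ≥ 2^{j+4}`. [folklore] -/
theorem floorsCor_dn_notMem_box {j m : ℕ} (hm : 2 ^ (j + 4) ≤ m) : dn m ∉ box 3 (2 ^ (j + 1)) := by
  obtain ⟨hd0, -, -⟩ := dn_coords m
  intro h
  have h1 : dn m 0 ≤ ((2 ^ (j + 1) : ℕ) : ℤ) := ((mem_box_three.1 h).1).2
  rw [hd0] at h1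
  have h2 : 2 ^ (j + 1) < 2 * m := by
    calc 2 ^ (j + 1) < 2 ^ (j + 4) := Nat.pow_lt_pow_right (by norm_num) (by omega)
      _ ≤ m := hm
      _ ≤ 2 * m := by omega
  have h3 : ((2 ^ (j + 1) : ℕ) : ℤ) < 2 * (m : ℤ) := by exact_mod_cast h2
  omega

/-- **Integrated form**: an event implying the separation event pointwise gives the separation event form.
[folklore] -/
theorem floorsCor_integral_mono {n r r' m : ℕ} {c : ℝ} (hup : up m ∈ box 3 n) (he : (e₂ : Site 3) ∈ box 3 n)
    (hd : dn m ∈ box 3 n) {E : BondConfig (Site 3) → Prop} [DecidablePred E]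
    (hE : ∀ ω, E ω → c * screenWeight n r 0 e₂ (dn m) ω ≤ screenWeight n r' 0 e₂ (dn m) ω) :
    ∫ ω, (if E ω then screenWeight n r 0 e₂ (dn m) ω else 0)
        ∂(sourcedDoubleCurrentLaw 3 n (criticalBeta 3) ({0} ∆ {up m}) ∅) ≤
      ∫ ω, (if c * screenWeight n r 0 e₂ (dn m) ω ≤ screenWeight n r' 0 e₂ (dn m) ω
          then screenWeight n r 0 e₂ (dn m) ω else 0)
        ∂(sourcedDoubleCurrentLaw 3 n (criticalBeta 3) ({0} ∆ {up m}) ∅) := by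
  haveI := floorsRed_isProbabilityMeasure (n := n) hup
  refine integral_mono_of_nonneg (ae_of_all _ fun ω => ?_) ?_ (ae_of_all _ fun ω => ?_)
  · show (0 : ℝ) ≤ if E ω then _ else 0
    split_ifs
    · exact floorsRed_screenWeight_nonneg he hd ω
    · exact le_rfl
  · refine floorsRed_integrable (|boxTwoPoint n ∅ e₂ (dn m)|⁻¹) fun ω => ?_
    split_ifs
    · exact floorsRed_abs_screenWeight_le n r 0 e₂ (dn m) ω
    · rw [abs_zero]; exact inv_nonneg.2 (abs_nonneg _)
  · show (if E ω then _ else (0 : ℝ)) ≤ if _ then _ else 0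
    by_cases hω : E ω
    · rw [if_pos hω, if_pos (hE ω hω)]
    · rw [if_neg hω]
      split_ifs
      · exact floorsRed_screenWeight_nonneg he hd ω
      · exact le_rfl

/-! ### The registered reduction -/

/-- **FLOORS FROM CORRIDOR SEPARATION UNDER THE SCREENING TILT** — registered helper of the open stub
`stub_floors`. For ANY finite corridor families `𝒬 j m` (octave geometry) and `𝒬' k m n` (bulk geometry): if the
one-strand box law tilted by `sw_r = 𝟙[e₂,dn∉C]·S(C_r)` charges with mass `≥ c·A(r;m)` the event "some corridor
`q ∋ e₂` (and `∋ dn m` in the bulk) is missed by the new piece of the explored duplicated cluster and carries a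
`c`-fraction of the depleted probe correlation, `c·S(C_r) ≤ S(C_r ∪ (Λ_{r'} ∖ q))`", then `Floors` holds (with
`δ = c²`): the corridor event forces `c·sw_r ≤ sw_{r'}` by Griffiths antitonicity, and `floors_of_separation`
concludes. The two conjuncts of the hypothesis are the separation lemma under the tilt fused with the depleted
corridor (Harnack/tube) estimate — the open content of the stub. [cite: Lawler1991, Ch. 3] -/
theorem floors_of_corridorSeparation : ∀ c : ℝ, 0 < c → ∀ 𝒬 : ℕ → ℕ → Finset (Finset (Site 3)), ∀ 𝒬' : ℕ → ℕ → ℕ → Finset (Finset (Site 3)), (∀ᶠ j : ℕ in atTop, ∀ m : ℕ, 2 ^ (j + 4) ≤ m → ∀ᶠ n : ℕ in atTop, c * pinchScreen n (2 ^ j) m ≤ ∫ ω, (if ∃ q ∈ 𝒬 j m, e₂ ∈ q ∧ Disjoint (innerCluster (2 ^ (j + 1)) 0 ω \ innerCluster (2 ^ j) 0 ω) q ∧ c * screening n (innerCluster (2 ^ j) 0 ω) e₂ (dn m) ≤ screening n (innerCluster (2 ^ j) 0 ω ∪ (box 3 (2 ^ (j + 1)) \ q)) e₂ (dn m) then screenWeight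 n (2 ^ j) 0 e₂ (dn m) ω else 0) ∂(sourcedDoubleCurrentLaw 3 n (criticalBeta 3) ({0} ∆ {up m}) ∅)) → (∀ᶠ k : ℕ in atTop, ∀ m : ℕ, 2 ^ (k + 3) ≤ m → m < 2 ^ (k + 4) → ∀ᶠ n : ℕ in atTop, c * pinchScreen n (2 ^ k) m ≤ ∫ ω, (if ∃ q ∈ 𝒬' k m n, e₂ ∈ q ∧ dn m ∈ q ∧ Disjoint (innerCluster n 0 ω \ innerCluster (2 ^ k) 0 ω) q ∧ c * screening n (innerCluster (2 ^ k) 0 ω) e₂ (dn m) ≤ screening n (innerCluster (2 ^ k) 0 ω ∪ (box 3 n \ q)) e₂ (dn m) then screenWeight n (2 ^ k) 0 e₂ (dn m) ω else 0) ∂(sourcedDoubleCurrentLaw 3 n (criticalBeta 3) ({0} ∆ {up m}) ∅)) → Floors := by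
  intro c hc 𝒬 𝒬' hoct hbulk
  refine floors_of_separation c hc ?_ ?_
  · filter_upwards [hoct] with j hj m hm
    filter_upwards [hj m hm, floorsRed_eventually_mem_box m] with n hn hbox
    refine hn.trans (floorsCor_integral_mono hbox.1 hbox.2.1 hbox.2.2 fun ω hω => ?_)
    obtain ⟨q, -, heq, hdis, hcq⟩ := hω
    exact floorsCor_pointwise hbox.2.1 hbox.2.2 heq
      (fun h => floorsCor_dn_notMem_box hm (Finset.mem_sdiff.1 h).1) hdis hcq
  · filter_upwards [hbulk] with k hk m hm hm'
    filter_upwards [hk m hm hm', floorsRed_eventually_mem_box m] with n hn hbox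
    refine hn.trans (floorsCor_integral_mono hbox.1 hbox.2.1 hbox.2.2 fun ω hω => ?_)
    obtain ⟨q, -, heq, hdq, hdis, hcq⟩ := hω
    exact floorsCor_pointwise hbox.2.1 hbox.2.2 heq (fun h => (Finset.mem_sdiff.1 h).2 hdq) hdis hcq

end Summit.CriticalPhenomena.Ising3DConformalLimit.EnergyNotSigmaSquaredGapForcesFarMerging

end
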